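import Summits.CriticalPhenomena.PercolationContinuityZ3.Theorems.Transplant.PlanarSkeletonPrisms
import Summits.CriticalPhenomena.PercolationContinuityZ3.Theorems.Transplant.PlanarSkeletonConcDefs
import HarnessLib

/-!
# Non-degeneracy certificate for the node of record: every `PlanarSkeletonConc` graph has at least QUADRATIC volume growth

builds on p205010 (kernel theorem, internal audit signed; external expert review pending) — nothing in this file uses p205010.
Lane `prim-bschramm`, seat `prim-bschramm-p5` (gen 4, the refuter; P5-SHARPNESS §21.1 (c), SHEAR-SCOPE §p5 item 5), helper file
(`--supports stmt-CriticalPhenomena-4575`).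

The interface field `step` (ι) of `PlanarSkeletonConc` (outward unit steps of the skeleton coordinate at every vertex) forces
`|B_G(w₀, 2m)| ≥ (m+1)²`: the `(m+1)²` planar points `φ w₀ + (i, j)`, `0 ≤ i, j ≤ m`, are projections of DISTINCT vertices at graph
distance `≤ i + j ≤ 2m` (p3-g4's `PlanarSkeleton.exists_mem_graphBall_φ_eq`, p229891).  Consequently no graph carrying a `PlanarSkeletonConc`
has linear growth; by Duminil-Copin–Goswami–Raoufi–Severo–Yadin (Duke Math. J. 169 (2020); NOT in the tree, not used here) every
quasi-transitive graph of superlinear growth has `p_c < 1`, so the binder `p < 1` / `p_c < 1` of the node of record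
`SamePDropOfSkeletonConcLt` costs nothing on its class, and the class lies inside the hypothesis `p_c < 1` of Benjamini–Schramm's
Conjecture 4 (the refuter's point: a counterexample to the node is a counterexample to the conjecture).  Degenerate skeletons (`φ`
bounded, e.g. the zero skeleton `PlanarSkeleton.zero` of p230074 on a two-ended graph) are thereby excluded from the Conc interface.
[cite: BenjaminiSchramm1996, Conj. 4] [cite: KozmaNitzan2024, §4 p. 26 ((29))]
-/

noncomputable section

namespace Summit.CriticalPhenomena.PercolationContinuityZ3.Theorems.Transplant

open Literature.Probability.LatticeModels
open Literature.Barriers.CriticalPhenomena (graphBall graphBall_finite graphBall_mono)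
open scoped Classical

namespace PlanarSkeletonConc

variable {V : Type} {G : SimpleGraph V} [G.LocallyFinite] (Φ : PlanarSkeletonConc G)

/-- The planar offsets `![i, j]` are pairwise distinct. [folklore] -/
theorem vec2_injective {i j i' j' : ℕ} (h : (![(i : ℤ), (j : ℤ)] : Site 2) = ![(i' : ℤ), (j' : ℤ)]) : i = i' ∧ j = j' := by
  have h0 := congrFun h 0
  have h1 := congrFun h 1
  simp only [Matrix.cons_val_zero, Matrix.cons_val_one, Nat.cast_inj] at h0 h1
  exact ⟨h0, h1⟩

/-- **A vertex over every near planar point**: for `i + j ≤ n` some vertex of `B_G(w₀, n)` projects to `φ w₀ + (i, j)` (field `step`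
via p3-g4's `exists_mem_graphBall_φ_eq`). [cite: KozmaNitzan2024, §4 p. 26 ((29))] -/
theorem exists_mem_graphBall_φ_eq_vec2 (w₀ : V) {i j n : ℕ} (h : i + j ≤ n) :
    ∃ g, g ∈ graphBall G w₀ n ∧ Φ.φ g = Φ.φ w₀ + ![(i : ℤ), (j : ℤ)] := by
  obtain ⟨g, hg, hφ⟩ := Φ.toPlanarSkeleton.exists_mem_graphBall_φ_eq Φ.step w₀ (Φ.φ w₀ + ![(i : ℤ), (j : ℤ)])
  refine ⟨g, graphBall_mono G w₀ ?_ hg, hφ⟩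
  have e0 : ((Φ.φ w₀ + ![(i : ℤ), (j : ℤ)]) 0 - Φ.φ w₀ 0).natAbs = i := by simp
  have e1 : ((Φ.φ w₀ + ![(i : ℤ), (j : ℤ)]) 1 - Φ.φ w₀ 1).natAbs = j := by simp
  rw [e0, e1]; exact h

include Φ in
/-- **QUADRATIC GROWTH of every `PlanarSkeletonConc` graph**: `(m + 1)² ≤ |B_G(w₀, 2m)|` at every vertex `w₀`.  In particular no
two-ended (linear-growth) graph carries the Conc interface, and — by Duminil-Copin–Goswami–Raoufi–Severo–Yadin 2020 (not in the tree) —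
every quasi-transitive graph carrying it has `p_c < 1`. [cite: BenjaminiSchramm1996, Conj. 4 (hypothesis p_c < 1)] -/
theorem sq_le_card_graphBall (w₀ : V) (m : ℕ) : (m + 1) ^ 2 ≤ (graphBall_finite G w₀ (2 * m)).toFinset.card := by
  -- choose a vertex over each planar point `φ w₀ + (i, j)`, `i, j ≤ m`
  have hch : ∀ q : Fin (m + 1) × Fin (m + 1),
      ∃ g, g ∈ graphBall G w₀ (2 * m) ∧ Φ.φ g = Φ.φ w₀ + ![((q.1 : ℕ) : ℤ), ((q.2 : ℕ) : ℤ)] := fun q =>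
    Φ.exists_mem_graphBall_φ_eq_vec2 w₀ (by have := q.1.2; have := q.2.2; omega)
  choose f hf using hch
  have hinj : Function.Injective f := by
    intro q q' hqq'
    have h := (hf q).2
    rw [hqq', (hf q').2] at h
    have h' := vec2_injective (add_left_cancel h)
    exact Prod.ext (Fin.ext h'.1.symm) (Fin.ext h'.2.symm)
  have hsub : (Finset.univ.image f) ⊆ (graphBall_finite G w₀ (2 * m)).toFinset := by
    intro g hg
    obtain ⟨q, -, rfl⟩ := Finset.mem_image.1 hg
    exact (Set.Finite.mem_toFinset _).2 (hf q).1
  calc (m + 1) ^ 2 = (Finset.univ : Finset (Fin (m + 1) × Fin (m + 1))).card := by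
          simp [Finset.card_univ, pow_two]
    _ = (Finset.univ.image f).card := (Finset.card_image_of_injective _ hinj).symm
    _ ≤ _ := Finset.card_le_card hsub

end PlanarSkeletonConc

end Summit.CriticalPhenomena.PercolationContinuityZ3.Theorems.Transplant

end
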